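import Literature.MathematicalPhysics.QuantumFieldTheory.Balaban1983to89.B9Thm39Thm311AtLettersR
import Literature.MathematicalPhysics.QuantumFieldTheory.Balaban1983to89.B9Thm39ReadingFaithful

/-!
# `Balaban1983to89.B9Thm39OneCubeReadingAtLettersY` — T. Bałaban, *Propagators for lattice gauge theories in a background field*, Commun. Math.
# Phys. **99** (1985) 389–434 [Balaban1985BackgroundPropagators], rows 15–16 of the N06 knit (Theorem 3.9 ⇒ Theorem 3.2): the displayed
# Theorem-3.9 binder family of the certificate IS CONTENT-EQUIVALENT TO ONE PRINTED DISPLAY — Theorem 3.2's (3.48) read on the inverse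
# ((3.96)) at def-Y's genuine letter `L39 = Q′G′²Q′*` — witnessed by the DEGENERATE ONE-CUBE READING

[4] = T. Bałaban, *Propagators and renormalization transformations for lattice gauge theories. II*, Commun. Math. Phys. **96** (1984) 223–250
[`Balaban1984PropagatorsII`].

statement-level skeleton of published theorems with citation tags; proofs where landed; nothing here is a claim about the Yang–Mills mass gap

THE PRINTED LOCI (verbatim).  p. 398, Theorem 3.2: *«|(Q′(U)G′²(U)Q′\*(U))⁻¹(y, y′)| ≦ B₀(Lʲη)⁻⁴(L^{j′}η)^{−d}e^{−δ₀d(y,y′)}, y, y′ ∈ 𝔅»* (3.48);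
p. 409: *«C₀ = Σ_{□∈𝒟} h_□C_□h_□»* (3.87); p. 411: *«(Q′G′²Q′\*)⁻¹ = C₀(I − R)⁻¹ = Σ_{n=0}^∞ C₀Rⁿ … convergent in the weighted supremum norm on 𝔅
appearing in the inequality (3.48)»* (3.96); p. 413, Theorem 3.9: *«(Q′G′²Q′\*)⁻¹ = Σ_ω R′₀(□₀)R′_{α₁}(X₁)⋯R′_{αₙ}(Xₙ) … This theorem implies Theorem 3.2.»*;
[4] p. 232, (2.51): *«|(Tλ)(x)| ≦ K(y, y′)|λ|, x ∈ B^j(y), supp λ ⊂ B^{j′}(y′)»*.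

WHY THIS FILE (cell context; referee ref-A's WATCH-JSAT-N06 on dag-n06-d's certificate EDITION 8 `Thm/BalabanUVNodesN06AtOpsYNuOfRecordV6EPairMC`,
2026-08-27: *the joint satisfiability, at def-Y's instance, of the displayed member-local binder set*).  Rows 15–16 of that certificate display, for
Theorem 3.9, the family  { `ι39`, `κ39` (the cube and factor INDEX TYPES), `𝔬39` (the letters `S □, h_□, □̃, L, L_□, C_□, X∩𝔅, R′_α(X)` over the
carrier `X39`), `rd39` (the locality reading), nine reals `α39 α′ r39 δ39 θ39 B39 N39 a39 M39` with eleven sign provisos, `hst39 : StaticOK39Blk`,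
`hloc39 : Locality39Blk`, `h39 : … Reg335 … U → Local348Blk ∧ Identities395Blk ∧ Small285Blk ∧ Factors389Blk`, and the pins `hblk39`, `hL39` (the
GENUINE `(Q′G′²Q′*)(U)` = `B9Thm39ReadingAtLetters.L39`), `hEK39` }  and feed n06-j's face `B9Thm39ReadingAtLetters.t39_hksum_of_pins_opsYOfLetters`.
THIS FILE records, in kernel form, the LOCATED OBSERVATION that this family asserts EXACTLY ONE THING about def-Y's genuine letters, namely Theorem
3.2's display (3.48) READ ON THE INVERSE in [4]'s (2.51) block-majorant currency,

  `(3.48)⁻¹`:  ∀ members `x` with `M₁ ≤ M`, ∀ `α₀ ∈ (0, a₁∕(c35Y·M)]`, ∀ `U ∈ (3.35)`:  ∃ T, T·L39(U) = 1 ∧ L39(U)·T = 1 ∧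
               `HasMajorant blk39 T (B₀·(Lʲη)⁻⁴·e^{−δ₀ d(y,y′)})`       (= n06-j∕n06-i's `Conv348Blk` at the pinned letters),

and nothing of Theorem 3.9's walk structure:
* FORWARD (landed): the face's conclusion `B9.Thm39Printed … (fun x => (ops x).EK39)` carries `Converges U`, which under the pin `hEK39` IS
  `Conv348Blk (𝔬39 x) … U` (`converges_EK39OfOpsBlkVia`, `Iff.rfl`), and `Conv348Blk` reads only the pinned fields `.L`, `.blk` —
  `display348_of_thm39Printed` below (§2).
* BACKWARD (this file): the index types and the letters being FREE binders, the DEGENERATE ONE-CUBE READING — `ι := Unit`, `κ := Unit`, `S := 𝔅`,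
  `h ≡ 1`, `□̃ ≡ 1`, `L_□ := L`, `C_□(U) := Ring.inverse (L U)`, `X ∩ 𝔅 := ∅`, `R′ := 0`, `AgreeC := (=)`, `Agree := True` (`oneCubeOps39`,
  `oneCubeReading39`, §1) — satisfies `StaticOK39Blk` with `N₀ = 1` and `Locality39Blk` OUTRIGHT, and, from `(3.48)⁻¹` ALONE, `Local348Blk ∧
  Identities395Blk ∧ Small285Blk ∧ Factors389Blk` (the operator R of (3.95) VANISHES: `ropBlk_oneCube`); hence the landed face fires from ONE display:
  ★★ `t39_hksum_oneCube_opsYOfLetters` (§2; CASCADE-R twin `t39_hksum_oneCube_opsYOfLettersR`, §3; FAITHFUL-block-map twin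
  `t39_hksum_oneCube_opsYOfLetters_F` over n06-i's face, §4), and every rows-15–16 binder of edition 8 other
  than the `𝔈`-pin is inhabited at the one-cube letters from `(3.48)⁻¹`: ★ `binders1516_oneCube_of_display348`.

CONSEQUENCES (numbers, not adjectives).  (i) WATCH-JSAT-N06, rows 15–16: the 24 displayed binders are jointly satisfiable at def-Y's instance IFF the
one display `(3.48)⁻¹` is TRUE there for some constants `B₀, δ₀ > 0` and thresholds (backward at the same constants; forward through the landed face at
`(2N₀B₀·rowConst261(α′r), (1−α′)r)` and `Thm39Printed`'s thresholds); no cheaper witness exists in the tree — the guards do not bound (`MemberY.hMstar` is a FLOOR on `M = L·M_h`, `α₀` is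
∀-bound) and `U ≡ 1` lies in (3.35) at every member and every `α₀ > 0` (`B9BackgroundsKLevelV1P.reg335YP_one`), so ANY inhabitant proves (3.48) at
`U = 1` for all large `M`, i.e. [4] Prop. 2.3 (2.86)–(2.87) at def-Y's `L39 … 1` (N03's leg h23 `B6.Prop23Printed` states it at T8's `CinvTP`; the letters
bridge `L39 … 1 ↔ Q′G′(1)²Q′*` of T8 is NOT in the tree and is NOT claimed here).  (ii) For the planner and the consumers of `(ops x).EK39`: as displayed,
rows 15–16 do NOT enforce Theorem 3.9's walk structure (cubes □ ∈ 𝒟, the partition `Σh_□² = 1`, local inverses `C_□`, factors `R′_α(X)` localized in X,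
U-dependence through X̃⁵) — it lives in the free reading, whose only inhabitant constructible in the tree today is the degenerate one; a consumer of
`EK39.LocDep` (analyticity ∕ cluster expansions downstream) must pin `rd39` to the genuine agreement-on-X̃⁵ reading.  NOT a defect of the certificate
(the DAG consumes rows 15–16 only through `B9.thm32_of_thm39` → (3.48)); a face with ≈ 20 FEWER binders whose one display is a PRINTED theorem
statement is offered (§2–§3), the knit's choice.

HONEST SCOPE.  Finite-dimensional bookkeeping (a two-sided inverse is `Ring.inverse`; sums over `Unit`); nothing of [B9] or [4] is asserted — (3.48)
stays a DISPLAYED hypothesis of printed shape; NOT a node discharge, NOT summit progress; count-neutral; one finite 𝕋⁴ programme — nothing continuum,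
nothing about the mass gap.  Cell `pub-ymgap` (HUMAN RULING D-0062), Track A node N06 [B9], seat `pub-ymgap-dag-n06-j` (harness re-seat gen 14),
2026-08-27.  No `sorry`, no `axiom`, no `instance`, no `notation`; five `def`s (`oneCubeOps39`, `oneCubeReading39`, `oneCubeOps39Y`, `oneCubeOps39YR`, `oneCubeOps39YF`).
-/

noncomputable section

namespace Literature.MathematicalPhysics.QuantumFieldTheory.Balaban1983to89.B9Thm39OneCubeReadingAtLettersY

open Literature.MathematicalPhysics.QuantumFieldTheory.Balaban1983to89
open Finset B6RandomWalk B9Thm37Sum B9Thm34Ext B9Thm39Whole B9Thm39WholeBlk B9Thm39WholeBlkVia B9Thm39WholeBlkViaDatum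
  B9Thm39ReadingCoords B9Thm39ReadingAtLetters B9Thm39Thm311AtLettersR Node00
open B6KLevelCensusIndexV1 B9PinMembersKLevelV1 B9PinCarriersKLevelV1 B9PinGeometryKLevelV1 B7Prop2SpecialUnitary
open B9BackgroundsKLevelV1R B9GeoLemma21KLevelV1

/-! ## §1 The one-cube letters and the trivial reading over an abstract carrier -/

section Generic

variable (g : B9.Geometry) [Fintype g.Site] (B : B9.Backgrounds) {X : Type}

/-- **THE ONE-CUBE LETTERS** over a carrier `X` fibred over 𝔅 by `blk`, for an operator letter `L(U)` (print's `Q′G′²Q′*(U)`): ONE cube index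
(`ι := Unit`) with `S := 𝔅`, `h ≡ 1`, `□̃ ≡ 1`, `L_□ := L`, `C_□(U) := Ring.inverse (L U)` (the two-sided inverse when it exists, `0` otherwise); ONE
factor index (`κ := Unit`) with `X ∩ 𝔅 := ∅`, `R′ := 0` — the degenerate instance of the letter record of (3.87) ∕ (3.95) ∕ (3.98) under which
C₀ = C(U) and the expansion (3.98) has the single non-zero term C(U).  A DEGENERATE READING for bookkeeping, not print's cubes.
[cite: Balaban1985BackgroundPropagators, (3.87) p.409 + (3.95) p.411 + (3.98) p.413 (the letters; degenerate instance)] -/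
def oneCubeOps39 (blk : X → g.Site) (L : B.Cfg → Module.End ℝ (X → ℝ)) : Ops39Blk g B X Unit Unit where
  blk := blk
  S := fun _ => univ
  h := fun _ _ => 1
  chi := fun _ _ => 1
  L := L
  Lloc := fun U _ => L U
  Cl := fun U _ => Ring.inverse (L U)
  Sw := fun _ => ∅
  Rw := fun _ _ => 0

/-- **THE TRIVIAL LOCALITY READING**: the head term «agrees» only at equal configurations (C(U) depends on all of U), the zero factor at all
pairs. [cite: Balaban1985BackgroundPropagators, Cor. 3.8 p.410 + Thm 3.9 p.413 (the locality clauses; degenerate instance)] -/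
def oneCubeReading39 : WalkReading39 B Unit Unit where
  AgreeC := fun _ U U' => U = U'
  Agree := fun _ _ _ => True

variable {g B}

/-- the block map of the one-cube letters is `blk`. [cite: Balaban1985BackgroundPropagators, (3.87) p.409, bookkeeping] -/
theorem oneCubeOps39_blk (blk : X → g.Site) (L : B.Cfg → Module.End ℝ (X → ℝ)) : (oneCubeOps39 g B blk L).blk = blk := rfl

/-- the operator letter of the one-cube letters is `L`. [cite: Balaban1985BackgroundPropagators, (3.95) p.411, bookkeeping] -/
theorem oneCubeOps39_L (blk : X → g.Site) (L : B.Cfg → Module.End ℝ (X → ℝ)) : (oneCubeOps39 g B blk L).L = L := rfl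

/-- multiplication by the constant function 1 is the identity operator. [folklore] -/
private theorem mulOp_const_one : mulOp (fun _ : X => (1 : ℝ)) = (1 : Module.End ℝ (X → ℝ)) := by
  apply LinearMap.ext
  intro μ
  funext x
  simp [mulOp_apply]

/-- the zero operator has every non-negative (2.51)-majorant. [cite: Balaban1984PropagatorsII, (2.51) p.232, bookkeeping] -/
theorem hasMajorant_zero_of_nonneg (blk : X → g.Site) {K : g.Site → g.Site → ℝ} (hK : ∀ a b, 0 ≤ K a b) :
    HasMajorant (g := b6 g) blk (0 : Module.End ℝ (X → ℝ)) K := by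
  intro y' μ Bd hμ x
  simp only [LinearMap.zero_apply, Pi.zero_apply, abs_zero]
  exact mul_nonneg (hK _ _) hμ.nonneg

/-- a two-sided inverse IS `Ring.inverse`. [folklore] -/
private theorem ring_inverse_eq_of_two_sided {a T : Module.End ℝ (X → ℝ)} (h1 : T * a = 1) (h2 : a * T = 1) :
    Ring.inverse a = T := by
  have hu : IsUnit a := ⟨⟨a, T, h2, h1⟩, rfl⟩
  calc Ring.inverse a = Ring.inverse a * (a * T) := by rw [h2, mul_one]
    _ = Ring.inverse a * a * T := by rw [mul_assoc]
    _ = T := by rw [Ring.inverse_mul_cancel a hu, one_mul]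

/-- `0 ≤ (if p then v else 0)` for `0 ≤ v`, whatever decides `p`. [folklore] -/
private theorem ite_nonneg_zero {p : Prop} [Decidable p] {v : ℝ} (hv : 0 ≤ v) : 0 ≤ (if p then v else 0) := by
  split_ifs
  · exact hv
  · exact le_rfl

/-- ★ **`Conv348Blk` AT THE ONE-CUBE LETTERS IS (3.48) READ ON THE INVERSE** (`Iff.rfl`): `L(U)` has a two-sided inverse with the block majorant
`B₁(Lʲη)⁻⁴e^{−δ₁d(y,y′)}` w.r.t. `blk`. [cite: Balaban1985BackgroundPropagators, Thm 3.2 (3.48) p.398 + (3.96) p.411; Balaban1984PropagatorsII, (2.51) p.232] -/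
theorem conv348Blk_oneCube_iff (blk : X → g.Site) (L : B.Cfg → Module.End ℝ (X → ℝ)) (B₁ δ₁ : ℝ) (U : B.Cfg) :
    Conv348Blk (oneCubeOps39 g B blk L) B₁ δ₁ U ↔
      ∃ T : Module.End ℝ (X → ℝ), T * L U = 1 ∧ L U * T = 1 ∧
        HasMajorant (g := b6 g) blk T (fun (a b : g.Site) => B₁ * g.len a ^ (-(4 : ℝ)) * Real.exp (-(δ₁ * g.dist a b))) :=
  Iff.rfl

/-- **`Conv348Blk` READS ONLY THE PINNED FIELDS `.L`, `.blk`**: it transfers between any two letter records (over any index types) with the same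
operator letter and block map. [cite: Balaban1985BackgroundPropagators, (3.96) p.411, bookkeeping] -/
theorem conv348Blk_of_pins {ι κ ι' κ' : Type} (𝔬 : Ops39Blk g B X ι κ) (𝔬' : Ops39Blk g B X ι' κ')
    (hL : 𝔬'.L = 𝔬.L) (hblk : 𝔬'.blk = 𝔬.blk) {B₁ δ₁ : ℝ} {U : B.Cfg} (h : Conv348Blk 𝔬 B₁ δ₁ U) :
    Conv348Blk 𝔬' B₁ δ₁ U := by
  obtain ⟨T, h1, h2, h3⟩ := h
  refine ⟨T, ?_, ?_, ?_⟩
  · rw [hL]; exact h1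
  · rw [hL]; exact h2
  · rw [hblk]; exact h3

/-- **THE LOCALITY INPUTS HOLD AT THE TRIVIAL READING**: the head term agrees at equal configurations, the zero factor everywhere.
[cite: Balaban1985BackgroundPropagators, Cor. 3.8 p.410 + Thm 3.9 p.413, bookkeeping] -/
theorem locality39Blk_oneCube (blk : X → g.Site) (L : B.Cfg → Module.End ℝ (X → ℝ)) :
    Locality39Blk (oneCubeOps39 g B blk L) (oneCubeReading39 B) where
  cl := fun _ U U' (hUU' : U = U') => by subst hUU'; rfl
  rw := fun _ _ _ _ => rfl

/-- ★ **THE OPERATOR R OF (3.95) VANISHES AT THE ONE-CUBE LETTERS**: with `□̃ ≡ 1`, `h ≡ 1`, `L_□ = L` each of the three sums of (3.95) is zero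
(`(1 − □̃) = 0`, `L − L_□ = 0`, `□̃L_□h − h□̃L_□ = 0`). [cite: Balaban1985BackgroundPropagators, (3.95) p.411 (degenerate instance)] -/
theorem ropBlk_oneCube (blk : X → g.Site) (L : B.Cfg → Module.End ℝ (X → ℝ)) (U : B.Cfg) :
    RopBlk (oneCubeOps39 g B blk L) U = 0 := by
  simp [RopBlk, oneCubeOps39, mulOp_const_one]

variable [DecidableEq g.Site]

/-- **THE STATIC DATA HOLD AT THE ONE-CUBE LETTERS with `N₀ = 1`** (given the metric facts of the geometry): `|h| ≦ 1`, `h ≠ 0` only over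
`S = 𝔅`, `Σ_□ h_□² = 1²`, `□̃h = h`, every site in exactly one `S_□`. [cite: Balaban1985BackgroundPropagators, p.408 + (3.87) p.409; Balaban1984PropagatorsII, (2.54) p.233] -/
theorem staticOK39Blk_oneCube (blk : X → g.Site) (L : B.Cfg → Module.End ℝ (X → ℝ))
    (htri : ∀ a b c : g.Site, g.dist a c ≤ g.dist a b + g.dist b c) (hrefl : ∀ y : g.Site, g.dist y y = 0)
    (hdnn : ∀ y y' : g.Site, 0 ≤ g.dist y y') (hlen : ∀ y : g.Site, 0 < g.len y) :
    StaticOK39Blk (oneCubeOps39 g B blk L) 1 where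
  tri := htri
  refl := hrefl
  dnn := hdnn
  lenpos := hlen
  hh := fun _ _ => by simp [oneCubeOps39]
  hS := fun _ x _ => Finset.mem_univ (blk x)
  hpu := fun _ => by simp [oneCubeOps39]
  hchi := fun _ _ => by simp [oneCubeOps39]
  cnt := fun _ => by simp [oneCubeOps39]

/-- ★ **THE FOUR THEOREM-3.9 SCHEMAS AT THE ONE-CUBE LETTERS FROM (3.48)-ON-THE-INVERSE ALONE**: `Local348Blk` (the one «local» inverse IS the
global inverse, with its majorant), `Identities395Blk` (`L·Ring.inverse L = 1`), `Small285Blk` for every `θ₀ ≧ 0` (R = 0), `Factors389Blk` (R′ = 0).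
[cite: Balaban1985BackgroundPropagators, Thm 3.2 (3.48) p.398 + (3.87) p.409 + (3.95)–(3.96) p.411 + (3.89) p.409; Balaban1984PropagatorsII, (2.51) p.232 + (2.85)–(2.86) p.238] -/
theorem schemas39_oneCube_of_conv348 (blk : X → g.Site) (L : B.Cfg → Module.End ℝ (X → ℝ)) {B₀ δ₀ θ₀ : ℝ} (r : ℝ)
    (hθ : 0 ≤ θ₀) (hM : 0 ≤ g.M) {U : B.Cfg} (h : Conv348Blk (oneCubeOps39 g B blk L) B₀ δ₀ U) :
    Local348Blk (oneCubeOps39 g B blk L) B₀ δ₀ U ∧ Identities395Blk (oneCubeOps39 g B blk L) U ∧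
      Small285Blk (oneCubeOps39 g B blk L) θ₀ r U ∧ Factors389Blk (oneCubeOps39 g B blk L) θ₀ δ₀ U := by
  obtain ⟨T, hTL, hLT, hK⟩ := h
  have hinv : Ring.inverse (L U) = T := ring_inverse_eq_of_two_sided hTL hLT
  have hKnn : ∀ (s : ℝ) (a b : g.Site), 0 ≤ θ₀ * g.M⁻¹ * Real.exp (-(s * g.dist a b)) := fun s a b =>
    mul_nonneg (mul_nonneg hθ (inv_nonneg.mpr hM)) (Real.exp_pos _).le
  refine ⟨⟨fun _ => ?_⟩, ⟨fun _ => ?_⟩, ⟨?_⟩, ⟨fun _ => ?_⟩⟩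
  · show HasMajorant (g := b6 g) blk (Ring.inverse (L U)) _
    rw [hinv]
    exact hK
  · show L U * Ring.inverse (L U) = 1
    rw [hinv]
    exact hLT
  · rw [ropBlk_oneCube]
    exact hasMajorant_zero_of_nonneg blk (hKnn r)
  · show HasMajorant (g := b6 g) blk (0 : Module.End ℝ (X → ℝ)) _
    exact hasMajorant_zero_of_nonneg blk fun a b => ite_nonneg_zero (hKnn δ₀ a b)

end Generic

/-! ## §2 At def-Y's letters, print's class `bg9Y`: rows 15 ∧ 16 from ONE display, the binder ledger, and the converse -/

section StageY

open scoped Matrix.Norms.L2Operator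

variable {N : ℕ} (θ : Stage3Params) (Mstar : ℕ) (𝔏 : LettersY N θ Mstar) (𝔈 : ExpsY N θ Mstar)
variable [∀ x : MemberY θ.d₆ θ.ℓ₆ θ.hd' θ.hL' θ.b₀ θ.b₁ Mstar, Fintype (geo9Y x).Site]
  [∀ x : MemberY θ.d₆ θ.ℓ₆ θ.hd' θ.hL' θ.b₀ θ.b₁ Mstar, DecidableEq (geo9Y x).Site]

omit [∀ x : MemberY θ.d₆ θ.ℓ₆ θ.hd' θ.hL' θ.b₀ θ.b₁ Mstar, DecidableEq (geo9Y x).Site] in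
/-- **THE ONE-CUBE LETTERS AT A MEMBER OF STAGE 3′(Y), PRINT's CLASS**: block map `blk39` (the representative bond of a carrier block), operator letter
`L39 x.toKIdx (𝔏 x).parS (𝔏 x).Gp` = the GENUINE `(Q′G′²Q′*)(U)` in print's units and real coordinates (n06-j `B9Thm39ReadingAtLetters.L39`).
[cite: Balaban1985BackgroundPropagators, (3.87) p.409 + (3.95) p.411 + Thm 3.2 p.398 (the letter `Q′G′²Q′*`; degenerate reading)] -/
def oneCubeOps39Y (x : MemberY θ.d₆ θ.ℓ₆ θ.hd' θ.hL' θ.b₀ θ.b₁ Mstar) :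
    Ops39Blk (geo9Y x) (bg9Y (Matrix (Fin N) (Fin N) ℂ) (specialUnitaryUnits (Fin N)) x) (X39 (Matrix (Fin N) (Fin N) ℂ) x.toKIdx) Unit Unit :=
  oneCubeOps39 (geo9Y x) (bg9Y (Matrix (Fin N) (Fin N) ℂ) (specialUnitaryUnits (Fin N)) x) (blk39 (Matrix (Fin N) (Fin N) ℂ) x.toKIdx)
    (L39 x.toKIdx (𝔏 x).parS (𝔏 x).Gp)

omit [∀ x : MemberY θ.d₆ θ.ℓ₆ θ.hd' θ.hL' θ.b₀ θ.b₁ Mstar, DecidableEq (geo9Y x).Site] in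
/-- the block-map pin `hblk39` holds at the one-cube letters by `rfl`. [cite: Balaban1984PropagatorsII, p.248 («sites replaced by bonds»), bookkeeping] -/
theorem oneCubeOps39Y_blk (x : MemberY θ.d₆ θ.ℓ₆ θ.hd' θ.hL' θ.b₀ θ.b₁ Mstar) :
    (oneCubeOps39Y θ Mstar 𝔏 x).blk = blk39 (Matrix (Fin N) (Fin N) ℂ) x.toKIdx := rfl

omit [∀ x : MemberY θ.d₆ θ.ℓ₆ θ.hd' θ.hL' θ.b₀ θ.b₁ Mstar, DecidableEq (geo9Y x).Site] in
/-- the operator pin `hL39` holds at the one-cube letters by `rfl`. [cite: Balaban1985BackgroundPropagators, Thm 3.2 p.398 (the letter `Q′G′²Q′*`), bookkeeping] -/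
theorem oneCubeOps39Y_L (x : MemberY θ.d₆ θ.ℓ₆ θ.hd' θ.hL' θ.b₀ θ.b₁ Mstar) :
    (oneCubeOps39Y θ Mstar 𝔏 x).L = L39 x.toKIdx (𝔏 x).parS (𝔏 x).Gp := rfl

omit [∀ x : MemberY θ.d₆ θ.ℓ₆ θ.hd' θ.hL' θ.b₀ θ.b₁ Mstar, Fintype (geo9Y x).Site]
  [∀ x : MemberY θ.d₆ θ.ℓ₆ θ.hd' θ.hL' θ.b₀ θ.b₁ Mstar, DecidableEq (geo9Y x).Site] in
/-- `0 ≤ M = L·M_h` at a member (n06-i's `geo9K_M_nonneg`, re-read at `geo9Y` without its site instance). [cite: Balaban1984PropagatorsII, (2.1) p.224, bookkeeping] -/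
theorem geo9Y_M_nonneg (x : MemberY θ.d₆ θ.ℓ₆ θ.hd' θ.hL' θ.b₀ θ.b₁ Mstar) : 0 ≤ (geo9Y x).M := by
  rw [geo9Y_M]
  positivity

/-- **`hst39` AT THE ONE-CUBE LETTERS OF A MEMBER** (`N₀ = 1`): the metric facts are the record's (`geo9Y_dist_triangle`, `geo9Y_dist_self`,
`geo9K_dist_nonneg'`, `geo9Y_len_pos`). [cite: Balaban1985BackgroundPropagators, p.408 + (3.87) p.409; Balaban1984PropagatorsII, (2.54) p.233] -/
theorem staticOK39Blk_oneCubeY (x : MemberY θ.d₆ θ.ℓ₆ θ.hd' θ.hL' θ.b₀ θ.b₁ Mstar) :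
    StaticOK39Blk (oneCubeOps39Y θ Mstar 𝔏 x) 1 :=
  staticOK39Blk_oneCube _ _ (geo9Y_dist_triangle x) (geo9Y_dist_self x) (geo9K_dist_nonneg' x.toKIdx) (geo9Y_len_pos x)

omit [∀ x : MemberY θ.d₆ θ.ℓ₆ θ.hd' θ.hL' θ.b₀ θ.b₁ Mstar, DecidableEq (geo9Y x).Site] in
/-- **`hloc39` AT THE ONE-CUBE LETTERS OF A MEMBER** (trivial reading). [cite: Balaban1985BackgroundPropagators, Cor. 3.8 p.410 + Thm 3.9 p.413, bookkeeping] -/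
theorem locality39Blk_oneCubeY (x : MemberY θ.d₆ θ.ℓ₆ θ.hd' θ.hL' θ.b₀ θ.b₁ Mstar) :
    Locality39Blk (oneCubeOps39Y θ Mstar 𝔏 x) (oneCubeReading39 _) :=
  locality39Blk_oneCube _ _

/-- **`h39` AT THE ONE-CUBE LETTERS FROM THE ONE DISPLAY `(3.48)⁻¹`** (any `θ₀ ≧ 0`, any rate `r`): member by member, configuration by configuration.
[cite: Balaban1985BackgroundPropagators, Thm 3.2 (3.48) p.398 + (3.96) p.411 + (3.35) p.396] -/
theorem h39_oneCubeY_of_display348 {B₀ δ₀ a₁ M₁ θ₀ : ℝ} (r : ℝ) (hθ : 0 ≤ θ₀)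
    (h348 : ∀ x : MemberY θ.d₆ θ.ℓ₆ θ.hd' θ.hL' θ.b₀ θ.b₁ Mstar, M₁ ≤ (geo9Y x).M → ∀ α₀ : ℝ, 0 < α₀ → c35Y * (geo9Y x).M * α₀ ≤ a₁ →
      ∀ U : (bg9Y (Matrix (Fin N) (Fin N) ℂ) (specialUnitaryUnits (Fin N)) x).Cfg,
        (bg9Y (Matrix (Fin N) (Fin N) ℂ) (specialUnitaryUnits (Fin N)) x).Reg335 c35Y α₀ U → Conv348Blk (oneCubeOps39Y θ Mstar 𝔏 x) B₀ δ₀ U)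
    (x : MemberY θ.d₆ θ.ℓ₆ θ.hd' θ.hL' θ.b₀ θ.b₁ Mstar) (hM : M₁ ≤ (geo9Y x).M) (α₀ : ℝ) (hα : 0 < α₀) (ha : c35Y * (geo9Y x).M * α₀ ≤ a₁)
    (U : (bg9Y (Matrix (Fin N) (Fin N) ℂ) (specialUnitaryUnits (Fin N)) x).Cfg)
    (hU : (bg9Y (Matrix (Fin N) (Fin N) ℂ) (specialUnitaryUnits (Fin N)) x).Reg335 c35Y α₀ U) :
    Local348Blk (oneCubeOps39Y θ Mstar 𝔏 x) B₀ δ₀ U ∧ Identities395Blk (oneCubeOps39Y θ Mstar 𝔏 x) U ∧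
      Small285Blk (oneCubeOps39Y θ Mstar 𝔏 x) θ₀ r U ∧ Factors389Blk (oneCubeOps39Y θ Mstar 𝔏 x) θ₀ δ₀ U :=
  schemas39_oneCube_of_conv348 _ _ r hθ (geo9Y_M_nonneg θ Mstar x) (h348 x hM α₀ hα ha U hU)

/-- ★★ **ROWS 15 ∧ 16 OF THE N06 KNIT AT def-Y's INSTANCE FROM ONE DISPLAY — Theorem 3.2's (3.48) READ ON THE INVERSE** — plus the letter
coherence `hC` and the `𝔈`-pin of `EK39` to the one-cube datum: for every letters family `𝔏` with `(𝔏 x).C = CY x.toKIdx (𝔏 x).parS (𝔏 x).Gp` and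
expansion letters `𝔈` with `(ops x).EK39 = EK39OfOpsBlkVia (oneCubeOps39Y θ M⋆ 𝔏 x) oneCubeReading39 (d+1) (2(1·B₀)·rowConst261 geo9Y (α′r)) ((1−α′)r)
(repSite39 x.toKIdx)`,  IF  for every member with `M₁ ≦ M`, every `α₀ > 0` with `c35Y·M·α₀ ≦ a₁` and every `U ∈ (3.35)` the genuine
`L39(U) = Q′G′²Q′*(U)` has a two-sided inverse with block majorant `B₀(Lʲη)⁻⁴e^{−δ₀d}` (display `h348`),  THEN  `B9.Thm39Printed … (fun x => (ops
x).EK39) ∧ B9.RWKernelSumYields … (fun x => (ops x).EK39) (fun x => (ops x).Cinv)` at `ops := opsYOfLetters N θ M⋆ 𝔏 𝔈` — the landed face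
`t39_hksum_of_pins_opsYOfLetters` at the one-cube letters (`α := 1∕2`, `θ₀ := 0`, `N₀ := 1`).  The face dag-n06-d's edition 8 calls with 24 binders,
here with `α′ r B₀ δ₀ a₁ M₁` + 7 sign provisos + `h348` + `hC` + `hEK39`. [cite: Balaban1985BackgroundPropagators, Thm 3.9 (3.98)–(3.99) p.413 + Thm 3.2 (3.48) p.398 + (3.96) p.411 + (3.35) p.396; Balaban1984PropagatorsII, (2.51) p.232 + Lemma 2.1 (2.61) p.234] -/
theorem t39_hksum_oneCube_opsYOfLetters (α' r B₀ δ₀ a₁ M₁ : ℝ)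
    (hα'0 : 0 < α') (hα'1 : α' < 1) (hr : 0 < r) (hrδ : r ≤ δ₀) (hB₀ : 0 < B₀) (ha₁ : 0 < a₁) (hM₁ : 0 < M₁)
    (h348 : ∀ x : MemberY θ.d₆ θ.ℓ₆ θ.hd' θ.hL' θ.b₀ θ.b₁ Mstar, M₁ ≤ (geo9Y x).M → ∀ α₀ : ℝ, 0 < α₀ → c35Y * (geo9Y x).M * α₀ ≤ a₁ →
      ∀ U : (bg9Y (Matrix (Fin N) (Fin N) ℂ) (specialUnitaryUnits (Fin N)) x).Cfg,
        (bg9Y (Matrix (Fin N) (Fin N) ℂ) (specialUnitaryUnits (Fin N)) x).Reg335 c35Y α₀ U → Conv348Blk (oneCubeOps39Y θ Mstar 𝔏 x) B₀ δ₀ U)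
    (hC : ∀ x : MemberY θ.d₆ θ.ℓ₆ θ.hd' θ.hL' θ.b₀ θ.b₁ Mstar, (𝔏 x).C = CY x.toKIdx (𝔏 x).parS (𝔏 x).Gp)
    (hEK39 : ∀ x : MemberY θ.d₆ θ.ℓ₆ θ.hd' θ.hL' θ.b₀ θ.b₁ Mstar, ((opsYOfLetters N θ Mstar 𝔏 𝔈) x).EK39 =
      EK39OfOpsBlkVia (oneCubeOps39Y θ Mstar 𝔏 x) (oneCubeReading39 _) (θ.d₆ + 1)
        (2 * (1 * B₀) * B9RowSum261DefiniteFaces.rowConst261 (geo9Y (d := θ.d₆) (ℓ := θ.ℓ₆) (hd := θ.hd') (hL := θ.hL')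
          (b₀ := θ.b₀) (b₁ := θ.b₁) (Mstar := Mstar)) (α' * r)) ((1 - α') * r) (repSite39 x.toKIdx)) :
    B9.Thm39Printed (θ.d₆ + 1) c35Y geo9Y (bg9Y (Matrix (Fin N) (Fin N) ℂ) (specialUnitaryUnits (Fin N)))
        (fun x => ((opsYOfLetters N θ Mstar 𝔏 𝔈) x).EK39) ∧
      B9.RWKernelSumYields (θ.d₆ + 1) geo9Y (bg9Y (Matrix (Fin N) (Fin N) ℂ) (specialUnitaryUnits (Fin N)))
        (fun x => ((opsYOfLetters N θ Mstar 𝔏 𝔈) x).EK39) (fun x => ((opsYOfLetters N θ Mstar 𝔏 𝔈) x).Cinv) :=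
  t39_hksum_of_pins_opsYOfLetters θ Mstar 𝔏 𝔈 (fun x => oneCubeOps39Y θ Mstar 𝔏 x) (fun _ => oneCubeReading39 _)
    (1 / 2) α' r δ₀ 0 B₀ 1 a₁ M₁ one_half_pos one_half_lt_one hα'0 hα'1 hr hrδ le_rfl hB₀ zero_le_one ha₁ hM₁
    (fun x => staticOK39Blk_oneCubeY θ Mstar 𝔏 x) (fun x => locality39Blk_oneCubeY θ Mstar 𝔏 x)
    (fun x hM α₀ hα ha U hU => h39_oneCubeY_of_display348 θ Mstar 𝔏 r le_rfl h348 x hM α₀ hα ha U hU)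
    hC (fun _ => rfl) (fun _ => rfl) hEK39

/-- ★ **THE BINDER LEDGER OF ROWS 15–16 (WATCH-JSAT-N06 reading)**: from the one display `(3.48)⁻¹` at `(B₀, δ₀, a₁, M₁)` EVERY rows-15–16 binder of
the certificate other than the `𝔈`-pin — `hst39` (with `N39 := 1`), `hloc39`, `h39` (with `θ39 := 0`, any rate `r39`), `hblk39`, `hL39` — holds at the
one-cube letters `𝔬39 := oneCubeOps39Y`, `rd39 := oneCubeReading39`, `ι39 := κ39 := Unit` (the sign provisos are numerals' facts).  Hence the 24
displayed binders are JOINTLY SATISFIABLE at def-Y's instance as soon as `(3.48)⁻¹` holds there — and, by the landed face followed by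
`display348_of_thm39Printed`, only if it holds there at some constants and thresholds.
[cite: Balaban1985BackgroundPropagators, Thm 3.2 (3.48) p.398 + (3.87) p.409 + (3.95)–(3.96) p.411 + Thm 3.9 p.413; Balaban1984PropagatorsII, (2.51) p.232 + (2.54) p.233] -/
theorem binders1516_oneCube_of_display348 {B₀ δ₀ a₁ M₁ : ℝ} (r : ℝ)
    (h348 : ∀ x : MemberY θ.d₆ θ.ℓ₆ θ.hd' θ.hL' θ.b₀ θ.b₁ Mstar, M₁ ≤ (geo9Y x).M → ∀ α₀ : ℝ, 0 < α₀ → c35Y * (geo9Y x).M * α₀ ≤ a₁ →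
      ∀ U : (bg9Y (Matrix (Fin N) (Fin N) ℂ) (specialUnitaryUnits (Fin N)) x).Cfg,
        (bg9Y (Matrix (Fin N) (Fin N) ℂ) (specialUnitaryUnits (Fin N)) x).Reg335 c35Y α₀ U → Conv348Blk (oneCubeOps39Y θ Mstar 𝔏 x) B₀ δ₀ U) :
    (∀ x : MemberY θ.d₆ θ.ℓ₆ θ.hd' θ.hL' θ.b₀ θ.b₁ Mstar, StaticOK39Blk (oneCubeOps39Y θ Mstar 𝔏 x) 1) ∧
    (∀ x : MemberY θ.d₆ θ.ℓ₆ θ.hd' θ.hL' θ.b₀ θ.b₁ Mstar, Locality39Blk (oneCubeOps39Y θ Mstar 𝔏 x) (oneCubeReading39 _)) ∧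
    (∀ x : MemberY θ.d₆ θ.ℓ₆ θ.hd' θ.hL' θ.b₀ θ.b₁ Mstar, M₁ ≤ (geo9Y x).M → ∀ α₀ : ℝ, 0 < α₀ → c35Y * (geo9Y x).M * α₀ ≤ a₁ →
      ∀ U : (bg9Y (Matrix (Fin N) (Fin N) ℂ) (specialUnitaryUnits (Fin N)) x).Cfg,
        (bg9Y (Matrix (Fin N) (Fin N) ℂ) (specialUnitaryUnits (Fin N)) x).Reg335 c35Y α₀ U →
        Local348Blk (oneCubeOps39Y θ Mstar 𝔏 x) B₀ δ₀ U ∧ Identities395Blk (oneCubeOps39Y θ Mstar 𝔏 x) U ∧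
          Small285Blk (oneCubeOps39Y θ Mstar 𝔏 x) 0 r U ∧ Factors389Blk (oneCubeOps39Y θ Mstar 𝔏 x) 0 δ₀ U) ∧
    (∀ x : MemberY θ.d₆ θ.ℓ₆ θ.hd' θ.hL' θ.b₀ θ.b₁ Mstar, (oneCubeOps39Y θ Mstar 𝔏 x).blk = blk39 (Matrix (Fin N) (Fin N) ℂ) x.toKIdx) ∧
    (∀ x : MemberY θ.d₆ θ.ℓ₆ θ.hd' θ.hL' θ.b₀ θ.b₁ Mstar, (oneCubeOps39Y θ Mstar 𝔏 x).L = L39 x.toKIdx (𝔏 x).parS (𝔏 x).Gp) :=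
  ⟨fun x => staticOK39Blk_oneCubeY θ Mstar 𝔏 x, fun x => locality39Blk_oneCubeY θ Mstar 𝔏 x,
    fun x hM α₀ hα ha U hU => h39_oneCubeY_of_display348 θ Mstar 𝔏 r le_rfl h348 x hM α₀ hα ha U hU, fun _ => rfl, fun _ => rfl⟩

/-- ★ **THE CONVERSE — THE ROWS' CONCLUSION RETURNS THE DISPLAY**: for ANY Theorem-3.9 letters `𝔬39` (any index types, any reading, any term
representatives `π`, any constants) pinned by `hblk39`, `hL39`, if a family of expansion data `E x = EK39OfOpsBlkVia (𝔬39 x) (rd39 x) d′ B₁ δ₁ (π x)`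
satisfies `B9.Thm39Printed (d+1) c35Y geo9Y bg9Y E`, then above its thresholds `(3.48)⁻¹` holds at `(B₁, δ₁)` at the one-cube letters — because
`Thm39Printed`'s convergence clause IS `Conv348Blk (𝔬39 x)` (`converges_EK39OfOpsBlkVia`) and `Conv348Blk` reads only `.L`, `.blk`.  With
`binders1516_oneCube_of_display348`: rows 15–16's displayed family and the one display are CONTENT-EQUIVALENT (up to the shape of the α₀-guard:
`M·α₀ ≦ a₀` here, `c35Y·M·α₀ ≦ a₁` there). [cite: Balaban1985BackgroundPropagators, Thm 3.9 p.413 («This theorem implies Theorem 3.2») + (3.96) p.411 + Thm 3.2 (3.48) p.398] -/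
theorem display348_of_thm39Printed {ι κ : MemberY θ.d₆ θ.ℓ₆ θ.hd' θ.hL' θ.b₀ θ.b₁ Mstar → Type}
    (𝔬39 : ∀ x : MemberY θ.d₆ θ.ℓ₆ θ.hd' θ.hL' θ.b₀ θ.b₁ Mstar,
      Ops39Blk (geo9Y x) (bg9Y (Matrix (Fin N) (Fin N) ℂ) (specialUnitaryUnits (Fin N)) x) (X39 (Matrix (Fin N) (Fin N) ℂ) x.toKIdx) (ι x) (κ x))
    (rd39 : ∀ x : MemberY θ.d₆ θ.ℓ₆ θ.hd' θ.hL' θ.b₀ θ.b₁ Mstar,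
      WalkReading39 (bg9Y (Matrix (Fin N) (Fin N) ℂ) (specialUnitaryUnits (Fin N)) x) (ι x) (κ x))
    (d' : ℕ) (B₁ δ₁ : ℝ) (π : ∀ x : MemberY θ.d₆ θ.ℓ₆ θ.hd' θ.hL' θ.b₀ θ.b₁ Mstar, (geo9Y x).Site → (geo9Y x).Site)
    (E : ∀ x : MemberY θ.d₆ θ.ℓ₆ θ.hd' θ.hL' θ.b₀ θ.b₁ Mstar,
      B9.RWKernelExpansion (geo9Y x) (bg9Y (Matrix (Fin N) (Fin N) ℂ) (specialUnitaryUnits (Fin N)) x))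
    (hE : ∀ x, E x = EK39OfOpsBlkVia (𝔬39 x) (rd39 x) d' B₁ δ₁ (π x))
    (hblk : ∀ x, (𝔬39 x).blk = blk39 (Matrix (Fin N) (Fin N) ℂ) x.toKIdx)
    (hL : ∀ x, (𝔬39 x).L = L39 x.toKIdx (𝔏 x).parS (𝔏 x).Gp)
    (h39 : B9.Thm39Printed (θ.d₆ + 1) c35Y geo9Y (bg9Y (Matrix (Fin N) (Fin N) ℂ) (specialUnitaryUnits (Fin N))) E) :
    ∃ M₂ a₀ : ℝ, 0 < M₂ ∧ 0 < a₀ ∧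
      ∀ x : MemberY θ.d₆ θ.ℓ₆ θ.hd' θ.hL' θ.b₀ θ.b₁ Mstar, M₂ ≤ (geo9Y x).M → ∀ α₀ : ℝ, 0 < α₀ → (geo9Y x).M * α₀ ≤ a₀ →
        ∀ U : (bg9Y (Matrix (Fin N) (Fin N) ℂ) (specialUnitaryUnits (Fin N)) x).Cfg,
          (bg9Y (Matrix (Fin N) (Fin N) ℂ) (specialUnitaryUnits (Fin N)) x).Reg335 c35Y α₀ U → Conv348Blk (oneCubeOps39Y θ Mstar 𝔏 x) B₁ δ₁ U := by
  obtain ⟨M₂, a₀, _, _, _, hM₂, ha₀, -, -, -, H⟩ := h39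
  refine ⟨M₂, a₀, hM₂, ha₀, fun x hM α₀ hα hMa U hU => ?_⟩
  have hconv : (E x).Converges U := (H x hM α₀ hα hMa U hU).1
  rw [hE x] at hconv
  exact conv348Blk_of_pins (𝔬39 x) (oneCubeOps39Y θ Mstar 𝔏 x) ((oneCubeOps39Y_L θ Mstar 𝔏 x).trans (hL x).symm)
    ((oneCubeOps39Y_blk θ Mstar 𝔏 x).trans (hblk x).symm) ((converges_EK39OfOpsBlkVia _ _ _ _ _ _ _).1 hconv)

/-- ★ **THE 24 BINDERS RETURN THE ONE DISPLAY** (the loop closed in kernel): from rows 15–16's displayed family EXACTLY AS THE CERTIFICATE TYPES IT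
(any index types, letters, reading, constants; `hst39 hloc39 h39 hC hblk39 hL39 hEK39`) the landed face gives `Thm39Printed`, whence `(3.48)⁻¹` at the
one-cube letters with the constants `(2(N₀B₀)·rowConst261 geo9Y (α′r), (1−α′)r)` of the pin and `Thm39Printed`'s thresholds.  Together with
`t39_hksum_oneCube_opsYOfLetters` ∕ `binders1516_oneCube_of_display348`: the binder family and the display are CONTENT-EQUIVALENT up to constants and the
shape of the α₀-guard. [cite: Balaban1985BackgroundPropagators, Thm 3.9 p.413 («This theorem implies Theorem 3.2») + Thm 3.2 (3.48) p.398 + (3.96) p.411; Balaban1984PropagatorsII, Lemma 2.1 (2.61) p.234] -/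
theorem display348_of_binders1516 {ι κ : MemberY θ.d₆ θ.ℓ₆ θ.hd' θ.hL' θ.b₀ θ.b₁ Mstar → Type} [∀ x, Fintype (ι x)]
    (𝔬39 : ∀ x : MemberY θ.d₆ θ.ℓ₆ θ.hd' θ.hL' θ.b₀ θ.b₁ Mstar,
      Ops39Blk (geo9Y x) (bg9Y (Matrix (Fin N) (Fin N) ℂ) (specialUnitaryUnits (Fin N)) x) (X39 (Matrix (Fin N) (Fin N) ℂ) x.toKIdx) (ι x) (κ x))
    (rd39 : ∀ x : MemberY θ.d₆ θ.ℓ₆ θ.hd' θ.hL' θ.b₀ θ.b₁ Mstar,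
      WalkReading39 (bg9Y (Matrix (Fin N) (Fin N) ℂ) (specialUnitaryUnits (Fin N)) x) (ι x) (κ x))
    (α α' r δ₀ θ₀ B₀ N₀ a₁ M₁ : ℝ)
    (hα : 0 < α) (hα1 : α < 1) (hα'0 : 0 < α') (hα'1 : α' < 1) (hr : 0 < r) (hrδ : r ≤ δ₀) (hθ₀ : 0 ≤ θ₀) (hB₀ : 0 < B₀)
    (hN₀ : 0 ≤ N₀) (ha₁ : 0 < a₁) (hM₁ : 0 < M₁)
    (hst : ∀ x, StaticOK39Blk (𝔬39 x) N₀) (hloc : ∀ x, Locality39Blk (𝔬39 x) (rd39 x))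
    (h39 : ∀ x : MemberY θ.d₆ θ.ℓ₆ θ.hd' θ.hL' θ.b₀ θ.b₁ Mstar, M₁ ≤ (geo9Y x).M → ∀ α₀ : ℝ, 0 < α₀ → c35Y * (geo9Y x).M * α₀ ≤ a₁ →
      ∀ U : (bg9Y (Matrix (Fin N) (Fin N) ℂ) (specialUnitaryUnits (Fin N)) x).Cfg,
        (bg9Y (Matrix (Fin N) (Fin N) ℂ) (specialUnitaryUnits (Fin N)) x).Reg335 c35Y α₀ U →
        Local348Blk (𝔬39 x) B₀ δ₀ U ∧ Identities395Blk (𝔬39 x) U ∧ Small285Blk (𝔬39 x) θ₀ r U ∧ Factors389Blk (𝔬39 x) θ₀ δ₀ U)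
    (hC : ∀ x : MemberY θ.d₆ θ.ℓ₆ θ.hd' θ.hL' θ.b₀ θ.b₁ Mstar, (𝔏 x).C = CY x.toKIdx (𝔏 x).parS (𝔏 x).Gp)
    (hblk : ∀ x, (𝔬39 x).blk = blk39 (Matrix (Fin N) (Fin N) ℂ) x.toKIdx)
    (hL : ∀ x, (𝔬39 x).L = L39 x.toKIdx (𝔏 x).parS (𝔏 x).Gp)
    (hEK39 : ∀ x : MemberY θ.d₆ θ.ℓ₆ θ.hd' θ.hL' θ.b₀ θ.b₁ Mstar, ((opsYOfLetters N θ Mstar 𝔏 𝔈) x).EK39 =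
      EK39OfOpsBlkVia (𝔬39 x) (rd39 x) (θ.d₆ + 1)
        (2 * (N₀ * B₀) * B9RowSum261DefiniteFaces.rowConst261 (geo9Y (d := θ.d₆) (ℓ := θ.ℓ₆) (hd := θ.hd') (hL := θ.hL')
          (b₀ := θ.b₀) (b₁ := θ.b₁) (Mstar := Mstar)) (α' * r)) ((1 - α') * r) (repSite39 x.toKIdx)) :
    ∃ M₂ a₀ : ℝ, 0 < M₂ ∧ 0 < a₀ ∧
      ∀ x : MemberY θ.d₆ θ.ℓ₆ θ.hd' θ.hL' θ.b₀ θ.b₁ Mstar, M₂ ≤ (geo9Y x).M → ∀ α₀ : ℝ, 0 < α₀ → (geo9Y x).M * α₀ ≤ a₀ →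
        ∀ U : (bg9Y (Matrix (Fin N) (Fin N) ℂ) (specialUnitaryUnits (Fin N)) x).Cfg,
          (bg9Y (Matrix (Fin N) (Fin N) ℂ) (specialUnitaryUnits (Fin N)) x).Reg335 c35Y α₀ U →
            Conv348Blk (oneCubeOps39Y θ Mstar 𝔏 x)
              (2 * (N₀ * B₀) * B9RowSum261DefiniteFaces.rowConst261 (geo9Y (d := θ.d₆) (ℓ := θ.ℓ₆) (hd := θ.hd') (hL := θ.hL')
                (b₀ := θ.b₀) (b₁ := θ.b₁) (Mstar := Mstar)) (α' * r)) ((1 - α') * r) U :=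
  display348_of_thm39Printed θ Mstar 𝔏 𝔬39 rd39 (θ.d₆ + 1) _ _ (fun x => repSite39 x.toKIdx)
    (fun x => ((opsYOfLetters N θ Mstar 𝔏 𝔈) x).EK39) hEK39 hblk hL
    (t39_hksum_of_pins_opsYOfLetters θ Mstar 𝔏 𝔈 𝔬39 rd39 α α' r δ₀ θ₀ B₀ N₀ a₁ M₁ hα hα1 hα'0 hα'1 hr hrδ hθ₀ hB₀ hN₀ ha₁ hM₁
      hst hloc h39 hC hblk hL hEK39).1

end StageY

/-! ## §3 The CASCADE-R twin: rows 15 ∧ 16 at generic `(R₁, R₂)` from ONE display -/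

section StageYR

open scoped Matrix.Norms.L2Operator

variable {N : ℕ} (θ : Stage3Params) (Mstar : ℕ) (𝔏 : LettersY N θ Mstar) (𝔈 : ExpsY N θ Mstar)
variable [∀ x : MemberY θ.d₆ θ.ℓ₆ θ.hd' θ.hL' θ.b₀ θ.b₁ Mstar, Fintype (geo9Y x).Site]
  [∀ x : MemberY θ.d₆ θ.ℓ₆ θ.hd' θ.hL' θ.b₀ θ.b₁ Mstar, DecidableEq (geo9Y x).Site]
variable (R₁ R₂ : RegFamY θ.d₆ θ.ℓ₆ θ.hd' θ.hL' θ.b₀ θ.b₁ Mstar (Matrix (Fin N) (Fin N) ℂ))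

omit [∀ x : MemberY θ.d₆ θ.ℓ₆ θ.hd' θ.hL' θ.b₀ θ.b₁ Mstar, DecidableEq (geo9Y x).Site] in
/-- **THE ONE-CUBE LETTERS AT A MEMBER, CLASS-PARAMETRIC TYPING** (`bg9YR … R₁ R₂`, same configurations, same `blk39` ∕ `L39`).
[cite: Balaban1985BackgroundPropagators, (3.87) p.409 + (3.95) p.411 + Thm 3.2 p.398 (degenerate reading; class-parametric carrier)] -/
def oneCubeOps39YR (x : MemberY θ.d₆ θ.ℓ₆ θ.hd' θ.hL' θ.b₀ θ.b₁ Mstar) :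
    Ops39Blk (geo9Y x) (bg9YR (Matrix (Fin N) (Fin N) ℂ) (specialUnitaryUnits (Fin N)) R₁ R₂ x) (X39 (Matrix (Fin N) (Fin N) ℂ) x.toKIdx)
      Unit Unit :=
  oneCubeOps39 (geo9Y x) (bg9YR (Matrix (Fin N) (Fin N) ℂ) (specialUnitaryUnits (Fin N)) R₁ R₂ x) (blk39 (Matrix (Fin N) (Fin N) ℂ) x.toKIdx)
    (L39 x.toKIdx (𝔏 x).parS (𝔏 x).Gp)

/-- ★ **ROWS 15 ∧ 16 AT GENERIC `(R₁, R₂)` FROM ONE DISPLAY** — the CASCADE-R twin of `t39_hksum_oneCube_opsYOfLetters` over n06-j's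
`B9Thm39Thm311AtLettersR.t39_hksum_of_pins_opsYOfLettersR` (conclusions through `rwKernelExpansionR` ∕ `siteKernelR`, the `carriersYR` slots); the
display's proviso is `(bg9YR … R₁ R₂ x).Reg335 c35Y α₀ U` (= `R₁ x c35Y α₀ U`). [cite: Balaban1985BackgroundPropagators, Thm 3.9 (3.98)–(3.99) p.413 + Thm 3.2 (3.48) p.398 + (3.96) p.411; Balaban1984PropagatorsII, (2.51) p.232 + Lemma 2.1 (2.61) p.234] -/
theorem t39_hksum_oneCube_opsYOfLettersR (α' r B₀ δ₀ a₁ M₁ : ℝ)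
    (hα'0 : 0 < α') (hα'1 : α' < 1) (hr : 0 < r) (hrδ : r ≤ δ₀) (hB₀ : 0 < B₀) (ha₁ : 0 < a₁) (hM₁ : 0 < M₁)
    (h348 : ∀ x : MemberY θ.d₆ θ.ℓ₆ θ.hd' θ.hL' θ.b₀ θ.b₁ Mstar, M₁ ≤ (geo9Y x).M → ∀ α₀ : ℝ, 0 < α₀ → c35Y * (geo9Y x).M * α₀ ≤ a₁ →
      ∀ U : (bg9YR (Matrix (Fin N) (Fin N) ℂ) (specialUnitaryUnits (Fin N)) R₁ R₂ x).Cfg,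
        (bg9YR (Matrix (Fin N) (Fin N) ℂ) (specialUnitaryUnits (Fin N)) R₁ R₂ x).Reg335 c35Y α₀ U →
          Conv348Blk (oneCubeOps39YR θ Mstar 𝔏 R₁ R₂ x) B₀ δ₀ U)
    (hC : ∀ x : MemberY θ.d₆ θ.ℓ₆ θ.hd' θ.hL' θ.b₀ θ.b₁ Mstar, (𝔏 x).C = CY x.toKIdx (𝔏 x).parS (𝔏 x).Gp)
    (hEK39 : ∀ x : MemberY θ.d₆ θ.ℓ₆ θ.hd' θ.hL' θ.b₀ θ.b₁ Mstar,
      rwKernelExpansionR R₁ R₂ ((opsYOfLetters N θ Mstar 𝔏 𝔈) x).EK39 =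
      EK39OfOpsBlkVia (oneCubeOps39YR θ Mstar 𝔏 R₁ R₂ x) (oneCubeReading39 _) (θ.d₆ + 1)
        (2 * (1 * B₀) * B9RowSum261DefiniteFaces.rowConst261 (geo9Y (d := θ.d₆) (ℓ := θ.ℓ₆) (hd := θ.hd') (hL := θ.hL')
          (b₀ := θ.b₀) (b₁ := θ.b₁) (Mstar := Mstar)) (α' * r)) ((1 - α') * r) (repSite39 x.toKIdx)) :
    B9.Thm39Printed (θ.d₆ + 1) c35Y geo9Y (bg9YR (Matrix (Fin N) (Fin N) ℂ) (specialUnitaryUnits (Fin N)) R₁ R₂)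
        (fun x => rwKernelExpansionR R₁ R₂ ((opsYOfLetters N θ Mstar 𝔏 𝔈) x).EK39) ∧
      B9.RWKernelSumYields (θ.d₆ + 1) geo9Y (bg9YR (Matrix (Fin N) (Fin N) ℂ) (specialUnitaryUnits (Fin N)) R₁ R₂)
        (fun x => rwKernelExpansionR R₁ R₂ ((opsYOfLetters N θ Mstar 𝔏 𝔈) x).EK39)
        (fun x => siteKernelR R₁ R₂ ((opsYOfLetters N θ Mstar 𝔏 𝔈) x).Cinv) :=
  t39_hksum_of_pins_opsYOfLettersR θ Mstar 𝔏 𝔈 R₁ R₂ (fun x => oneCubeOps39YR θ Mstar 𝔏 R₁ R₂ x) (fun _ => oneCubeReading39 _)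
    (1 / 2) α' r δ₀ 0 B₀ 1 a₁ M₁ one_half_pos one_half_lt_one hα'0 hα'1 hr hrδ le_rfl hB₀ zero_le_one ha₁ hM₁
    (fun x => staticOK39Blk_oneCube _ _ (geo9Y_dist_triangle x) (geo9Y_dist_self x) (geo9K_dist_nonneg' x.toKIdx) (geo9Y_len_pos x))
    (fun _ => locality39Blk_oneCube _ _)
    (fun x hM α₀ hα ha U hU => schemas39_oneCube_of_conv348 _ _ r le_rfl (geo9Y_M_nonneg θ Mstar x) (h348 x hM α₀ hα ha U hU))
    hC (fun _ => rfl) (fun _ => rfl) hEK39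

end StageYR

/-! ## §4 The FAITHFUL block map: rows 15 ∧ 16 from ONE display at `blk39F bI` (n06-i's `t39_hksum_of_pins_opsYOfLetters_F`) -/

section StageYF

open scoped Matrix.Norms.L2Operator
open B9Ineq349SiteFromConv348 B9Thm39ReadingFaithful B6GlobalChartV1 B6Ineq2142KLevelV1

variable {N : ℕ} (θ : Stage3Params) (Mstar : ℕ) (𝔏 : LettersY N θ Mstar) (𝔈 : ExpsY N θ Mstar)
variable [∀ x : MemberY θ.d₆ θ.ℓ₆ θ.hd' θ.hL' θ.b₀ θ.b₁ Mstar, Fintype (geo9Y x).Site]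
  [∀ x : MemberY θ.d₆ θ.ℓ₆ θ.hd' θ.hL' θ.b₀ θ.b₁ Mstar, DecidableEq (geo9Y x).Site]
variable (bI : ∀ x : MemberY θ.d₆ θ.ℓ₆ θ.hd' θ.hL' θ.b₀ θ.b₁ Mstar, FBondY x.toKIdx → IBondY x.toKIdx)

omit [∀ x : MemberY θ.d₆ θ.ℓ₆ θ.hd' θ.hL' θ.b₀ θ.b₁ Mstar, DecidableEq (geo9Y x).Site] in
/-- **THE ONE-CUBE LETTERS AT A MEMBER ON THE FAITHFUL BLOCK MAP** `blk39F … (bI x)` (n06-i: every block — inner corners included — sits over a bond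
of its own level within torus distance 1; the block map rows 15–16 and row 25 can share), same operator letter `L39`.
[cite: Balaban1985BackgroundPropagators, (3.87) p.409 + Thm 3.2 (3.48) p.398; Balaban1984PropagatorsII, (2.45) p.231 + p.248 (degenerate reading; faithful representatives)] -/
def oneCubeOps39YF (x : MemberY θ.d₆ θ.ℓ₆ θ.hd' θ.hL' θ.b₀ θ.b₁ Mstar) :
    Ops39Blk (geo9Y x) (bg9Y (Matrix (Fin N) (Fin N) ℂ) (specialUnitaryUnits (Fin N)) x) (X39 (Matrix (Fin N) (Fin N) ℂ) x.toKIdx) Unit Unit :=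
  oneCubeOps39 (geo9Y x) (bg9Y (Matrix (Fin N) (Fin N) ℂ) (specialUnitaryUnits (Fin N)) x) (blk39F (Matrix (Fin N) (Fin N) ℂ) x.toKIdx (bI x))
    (L39 x.toKIdx (𝔏 x).parS (𝔏 x).Gp)

/-- ★★ **ROWS 15 ∧ 16 FROM ONE DISPLAY ON THE FAITHFUL BLOCK MAP**: as `t39_hksum_oneCube_opsYOfLetters`, with `(3.48)⁻¹` read w.r.t. `blk39F … (bI x)`
(so the majorant measures length and distance at a bond of the block's own level within torus distance 1 of it, also at inner-corner blocks) and
n06-i's one geometric binder `hβI` (`β ∘ bI ∘ β = β` on carrier blocks; the knit displays it already); fires n06-i's face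
`t39_hksum_of_pins_opsYOfLetters_F`.  The display to prefer when a member has inner corners (`B9BetaRangeKLevelV1`): w.r.t. the plain `blk39` every
inner-corner block is read at ONE arbitrary bond, and a UNIFORM majorant there is a condition on the representative, not on the operator.
[cite: Balaban1985BackgroundPropagators, Thm 3.9 (3.98)–(3.99) p.413 + Thm 3.2 (3.48) p.398 + (3.96) p.411; Balaban1984PropagatorsII, (2.45) p.231 + (2.51) p.232 + p.248 + Lemma 2.1 (2.61) p.234] -/
theorem t39_hksum_oneCube_opsYOfLetters_F (α' r B₀ δ₀ a₁ M₁ : ℝ)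
    (hα'0 : 0 < α') (hα'1 : α' < 1) (hr : 0 < r) (hrδ : r ≤ δ₀) (hB₀ : 0 < B₀) (ha₁ : 0 < a₁) (hM₁ : 0 < M₁)
    (h348 : ∀ x : MemberY θ.d₆ θ.ℓ₆ θ.hd' θ.hL' θ.b₀ θ.b₁ Mstar, M₁ ≤ (geo9Y x).M → ∀ α₀ : ℝ, 0 < α₀ → c35Y * (geo9Y x).M * α₀ ≤ a₁ →
      ∀ U : (bg9Y (Matrix (Fin N) (Fin N) ℂ) (specialUnitaryUnits (Fin N)) x).Cfg,
        (bg9Y (Matrix (Fin N) (Fin N) ℂ) (specialUnitaryUnits (Fin N)) x).Reg335 c35Y α₀ U → Conv348Blk (oneCubeOps39YF θ Mstar 𝔏 bI x) B₀ δ₀ U)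
    (hC : ∀ x : MemberY θ.d₆ θ.ℓ₆ θ.hd' θ.hL' θ.b₀ θ.b₁ Mstar, (𝔏 x).C = CY x.toKIdx (𝔏 x).parS (𝔏 x).Gp)
    (hβI : ∀ (x : MemberY θ.d₆ θ.ℓ₆ θ.hd' θ.hL' θ.b₀ θ.b₁ Mstar) (f : FBondY x.toKIdx) (c : IBondY x.toKIdx),
      blkV1 x.hN x.D f = β x.hN x.D x.hk c → β x.hN x.D x.hk (bI x f) = blkV1 x.hN x.D f)
    (hEK39 : ∀ x : MemberY θ.d₆ θ.ℓ₆ θ.hd' θ.hL' θ.b₀ θ.b₁ Mstar, ((opsYOfLetters N θ Mstar 𝔏 𝔈) x).EK39 =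
      EK39OfOpsBlkVia (oneCubeOps39YF θ Mstar 𝔏 bI x) (oneCubeReading39 _) (θ.d₆ + 1)
        (2 * (1 * B₀) * B9RowSum261DefiniteFaces.rowConst261 (geo9Y (d := θ.d₆) (ℓ := θ.ℓ₆) (hd := θ.hd') (hL := θ.hL')
          (b₀ := θ.b₀) (b₁ := θ.b₁) (Mstar := Mstar)) (α' * r)) ((1 - α') * r) (repSite39F x.toKIdx (bI x))) :
    B9.Thm39Printed (θ.d₆ + 1) c35Y geo9Y (bg9Y (Matrix (Fin N) (Fin N) ℂ) (specialUnitaryUnits (Fin N)))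
        (fun x => ((opsYOfLetters N θ Mstar 𝔏 𝔈) x).EK39) ∧
      B9.RWKernelSumYields (θ.d₆ + 1) geo9Y (bg9Y (Matrix (Fin N) (Fin N) ℂ) (specialUnitaryUnits (Fin N)))
        (fun x => ((opsYOfLetters N θ Mstar 𝔏 𝔈) x).EK39) (fun x => ((opsYOfLetters N θ Mstar 𝔏 𝔈) x).Cinv) :=
  t39_hksum_of_pins_opsYOfLetters_F θ Mstar 𝔏 𝔈 (fun x => oneCubeOps39YF θ Mstar 𝔏 bI x) (fun _ => oneCubeReading39 _)
    (1 / 2) α' r δ₀ 0 B₀ 1 a₁ M₁ one_half_pos one_half_lt_one hα'0 hα'1 hr hrδ le_rfl hB₀ zero_le_one ha₁ hM₁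
    (fun x => staticOK39Blk_oneCube _ _ (geo9Y_dist_triangle x) (geo9Y_dist_self x) (geo9K_dist_nonneg' x.toKIdx) (geo9Y_len_pos x))
    (fun _ => locality39Blk_oneCube _ _)
    (fun x hM α₀ hα ha U hU => schemas39_oneCube_of_conv348 _ _ r le_rfl (geo9Y_M_nonneg θ Mstar x) (h348 x hM α₀ hα ha U hU))
    hC hβI (fun _ => rfl) (fun _ => rfl) hEK39

end StageYF

end Literature.MathematicalPhysics.QuantumFieldTheory.Balaban1983to89.B9Thm39OneCubeReadingAtLettersY

end
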